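import Summits.BirchSwinnertonDyer.BirchSwinnertonDyer.Theorems.QuadraticBranchSignedControlPlusEtaNonsurjUncongruentFineTools
import Summits.BirchSwinnertonDyer.Rank1Residual.X10.CMPartnerCurvesA
import HarnessLib

/-!
# Route `QuadraticBranchSignedControl` (rung K8, cell `bsd-potss`): crux stmt-BirchSwinnertonDyer-19606
# `PlusEtaMainConjectureNonsurj` — UNCONGRUENT RECORDS AT THE SECOND GENUS-ZERO PRIME `p = 7`: record tools
# (the `p`-generic record shapes, the reference CM curves of the fields `ℚ(√−11)` and `ℚ(√−1)`)

WHY. The v7 stub `stub_etaMC_nonCM_uncongruent` of skeleton `Cruxes/PlusEtaMainConjectureNonsurj/Lines/birth.lean` (39fd0f5855aa)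
is a statement for EVERY prime `p ≥ 5`; its locus was certified in the kernel so far only at `p = 5` (k8eta-c2 g14: 326 of the 336
`X_ns⁺(5)` rows of height ≤ 20, `…UncongruentRecords01–44`, `…UncongruentRecordsFine01–04`). The doors are `p`-generic
(`EtaCartanField.not_exists_cmAnchor_of_nine_frob`, `…not_modPCongruent_of_frobeniusTrace_ne_of_j_eq`); this file re-keys the two
count-level record shapes of `…UncongruentRecords01` §0 / `…UncongruentFineTools` §2–§3 from the literal `5` to a prime parameter
`p ≥ 5` (`#E(𝔽_p) = p + 1` reads `a_p = 0`), and adds the reference CM curves needed at `p = 7`, where the class-number-one fields with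
`p` inert are `ℚ(√−1), ℚ(√−2), ℚ(√−11), ℚ(√−43), ℚ(√−67), ℚ(√−163)`: Cremona `121b1 = [0,−1,1,−7,10]` (`j = −32768`, the unique CM
`j` of field `ℚ(√−11)`) and `32a`-type `[0,0,0,−11,14]` (`j = 287496 = j(ℤ[2i])`; the other CM `j` of field `ℚ(√−1)` is `1728`, for
which the `±` twist door does not apply — quartic twists). Records: siblings `…UncongruentRecordsSeven01…` (the `X_ns⁺(7)` rows of
Zywina's parametrisation, height ≤ 20, kit job j308124).

* §0 `uncongruent_of_nine_counts_at`, `not_modPCongruent_of_counts_of_j_eq_at`, `uncongruentFine_of_counts_at` (prime `p ≥ 5`).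
* §1 reference curves: `j(121b1) = −32768` (its `Δ ≠ 0` / minimality are the tree's `X10.CMPartnerCurves.isElliptic_cm121b1` /
  `isGloballyMinimal_cm121b1`); `[0,0,0,−11,14]`: `Δ ≠ 0`, global minimality, `j = 287496` in the kernel.
* §2 `j_eq_of_hasCM_of_cmFieldDiscrOfJ_eq_neg_eleven` (`d_K = −11 ⟹ j = −32768`), `…_eq_neg_four` (`d_K = −4 ⟹ j ∈ {1728, 287496}`).

HONEST FRAMING (cell `bsd-potss`, run/shared/lean/pub/bsd-potss/; FULL-BSD rank ≤ 1 programme): TOOL THEOREMS ONLY (no definition,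
no named fact, no `sorry`, axioms standard). Nothing is booked; crux 19606 stays OPEN; (C1⁺_η) is proved for no row; `BSD(W, p)` is
claimed for no pair. Seat `bsd-potss-k8eta-c2` g15 (prover), `--supports stmt-BirchSwinnertonDyer-19606`.

References: [Zywina2015] §4.5 (X_ns⁺(7)); [Cremona1997] Table 1 (121b, 32a); [SilvermanAdvancedTopics1994] App. A §3;
[SilvermanAEC2009] VII.1 Rem. 1.1, VII.5 Prop. 5.1, X.5 Cor. 5.4.1; [Serre1972] §4.5; [Serre1981] §8.1 (238).
-/

set_option autoImplicit false
set_option linter.dupNamespace false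

noncomputable section

open scoped Classical

open WeierstrassCurve Literature.NumberTheory.EllipticCurves Literature.NumberTheory.EllipticCurves.Rank1Residual
  Literature.NumberTheory.EllipticCurves.Rank1Residual.X11RankOneCertificates
  Summit.BirchSwinnertonDyer.Rank1Residual.X11b Summit.BirchSwinnertonDyer.BirchSwinnertonDyer.Rank1Residual.IntModel
  Summit.BirchSwinnertonDyer.BirchSwinnertonDyer.Rank1Residual.X11RankOne
open Summit.BirchSwinnertonDyer.Rank1Residual.O6 (ModPCongruent)

namespace Summit.BirchSwinnertonDyer.BirchSwinnertonDyer.Theorems.EtaUncongruentRecordsSeven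

open Summit.BirchSwinnertonDyer.BirchSwinnertonDyer.Theorems.EtaCartanField
open Summit.BirchSwinnertonDyer.BirchSwinnertonDyer.Theorems.EtaUncongruentRecords
open Summit.BirchSwinnertonDyer.Rank1Residual.X10.CMPartnerCurves (isElliptic_cm121b1 isGloballyMinimal_cm121b1)

/-! ## §0 Record shapes at a prime `p ≥ 5` -/

/-- **Record shape at a prime `p ≥ 5`.** For `V = [a₁,…,a₆]` globally minimal with `p ∤ Δ` and `#E(𝔽_p) = p + 1` (`a_p = 0`), whose
`p`-adic tower is not onto, nine Frobenius data (one per class-number-one discriminant, via `frobDatum_of_count`) give the negated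
existential of `Sig.stub_etaMC_nonCM_uncongruent` at `p` («no globally minimal CM curve good at `p` with `a_p = 0` is `p`-congruent to `V`»).
The `p`-generic form of `EtaUncongruentRecords.uncongruent_of_nine_counts`. [cite: Serre1972, §4.5] [cite: NeukirchANT1999, Ch. I §8 Prop. (8.5)] -/
theorem uncongruent_of_nine_counts_at (V : WeierstrassCurve ℚ) [V.IsElliptic] [V.IsGloballyMinimal] (p : ℕ) [Fact p.Prime]
    (hp5 : 5 ≤ p) {a1 a2 a3 a4 a6 : ℤ} (hI : integralModelInt V = ⟨a1, a2, a3, a4, a6⟩)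
    (hΔp : ¬ (p : ℤ) ∣ discOf [a1, a2, a3, a4, a6]) (hcp : countPoints [a1, a2, a3, a4, a6] p = (p : ℤ) + 1)
    (hns : ¬ ∀ m : ℕ, V.HasSurjectiveModNGaloisRep (p ^ m : ℕ))
    (h : ∀ d ∈ ({-3, -4, -7, -8, -11, -19, -43, -67, -163} : Finset ℤ), ∃ (ℓ : ℕ) (_ : Fact ℓ.Prime),
      ℓ ≠ p ∧ ℓ ≠ 2 ∧ V.HasGoodReductionAtPrime ℓ ∧ ¬ (p : ℤ) ∣ V.frobeniusTrace ℓ ∧ jacobiSym d ℓ = -1) :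
    ¬ ∃ (V'' : WeierstrassCurve ℚ) (_ : V''.IsElliptic) (_ : V''.IsGloballyMinimal),
        V''.HasCM ∧ V''.HasGoodReductionAtPrime p ∧ V''.frobeniusTrace p = 0 ∧ ModPCongruent V'' V p := by
  have hp2 : p ≠ 2 := by omega
  obtain ⟨hgood, htr⟩ := good_and_frobeniusTrace_eq_of_countPoints hI p hp2 hΔp
  rw [hcp] at htr
  have hap : V.frobeniusTrace p = 0 := by rw [htr]; ring
  exact not_exists_cmAnchor_of_nine_frob V p hp5 hgood hap hns h

/-- **Fine door from counts at a prime `p`.** `V` (integral model `[a₁,…,a₆]`) is `p`-congruent to NO curve `A` with `j(A) = j(A₀)`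
(`A₀ = [b₁,…,b₆]` a reference curve, `j ∉ {0, 1728}`) as soon as one prime `ℓ ≠ 2, p` with `ℓ ∤ Δ(V)·Δ(A₀)` has
`a_ℓ(V) ≢ ±a_ℓ(A₀) (mod p)`, the two traces read off `countPoints`. The `p`-generic form of
`EtaUncongruentRecords.not_modPCongruent_of_counts_of_j_eq`. [cite: Serre1981, §8.1 (238)] [cite: SilvermanAEC2009, X.5 Cor. 5.4.1] -/
theorem not_modPCongruent_of_counts_of_j_eq_at (V : WeierstrassCurve ℚ) [V.IsElliptic] [V.IsGloballyMinimal] (p : ℕ) [Fact p.Prime]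
    {a1 a2 a3 a4 a6 : ℤ} (hI : integralModelInt V = ⟨a1, a2, a3, a4, a6⟩)
    (A₀ : WeierstrassCurve ℚ) [A₀.IsElliptic] [A₀.IsGloballyMinimal] {b1 b2 b3 b4 b6 : ℤ} (hI₀ : integralModelInt A₀ = ⟨b1, b2, b3, b4, b6⟩)
    (h0 : A₀.j ≠ 0) (h1728 : A₀.j ≠ 1728) {A : WeierstrassCurve ℚ} [A.IsElliptic] (hj : A.j = A₀.j)
    (ℓ : ℕ) [Fact ℓ.Prime] (hℓp : ℓ ≠ p) (hℓ2 : ℓ ≠ 2) (hΔ : ¬ (ℓ : ℤ) ∣ discOf [a1, a2, a3, a4, a6])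
    (hΔ₀ : ¬ (ℓ : ℤ) ∣ discOf [b1, b2, b3, b4, b6])
    (h1 : ¬ (p : ℤ) ∣ ((ℓ : ℤ) + 1 - countPoints [a1, a2, a3, a4, a6] ℓ) - ((ℓ : ℤ) + 1 - countPoints [b1, b2, b3, b4, b6] ℓ))
    (h2 : ¬ (p : ℤ) ∣ ((ℓ : ℤ) + 1 - countPoints [a1, a2, a3, a4, a6] ℓ) + ((ℓ : ℤ) + 1 - countPoints [b1, b2, b3, b4, b6] ℓ)) :
    ¬ ModPCongruent V A p := by
  obtain ⟨hgV, htV⟩ := good_and_frobeniusTrace_eq_of_countPoints hI ℓ hℓ2 hΔ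
  obtain ⟨hgA, htA⟩ := good_and_frobeniusTrace_eq_of_countPoints hI₀ ℓ hℓ2 hΔ₀
  refine not_modPCongruent_of_frobeniusTrace_ne_of_j_eq V p A₀ hj h0 h1728 ℓ hℓp hgV hgA ?_ ?_
  · rw [htV, htA]; exact h1
  · rw [htV, htA]; exact h2

/-- **Fine record shape at a prime `p ≥ 5`.** For `V = [a₁,…,a₆]` globally minimal, `p ∤ Δ`, `#E(𝔽_p) = p + 1`, `p`-adic tower not
onto: if every CM anchor with field `ℚ(√d₀)` is excluded (`htw`) and for each other class-number-one `d` a Frobenius datum is given,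
then NO globally minimal CM curve good at `p` with `a_p = 0` is `p`-congruent to `V` (negated existential of
`Sig.stub_etaMC_nonCM_uncongruent` at `p`). The `p`-generic form of `EtaUncongruentRecords.uncongruentFine_of_counts`.
[cite: Serre1972, §4.5] [cite: NeukirchANT1999, Ch. I §8 Prop. (8.5)] -/
theorem uncongruentFine_of_counts_at (V : WeierstrassCurve ℚ) [V.IsElliptic] [V.IsGloballyMinimal] (p : ℕ) [Fact p.Prime]
    (hp5 : 5 ≤ p) {a1 a2 a3 a4 a6 : ℤ} (hI : integralModelInt V = ⟨a1, a2, a3, a4, a6⟩)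
    (hΔp : ¬ (p : ℤ) ∣ discOf [a1, a2, a3, a4, a6]) (hcp : countPoints [a1, a2, a3, a4, a6] p = (p : ℤ) + 1)
    (hns : ¬ ∀ m : ℕ, V.HasSurjectiveModNGaloisRep (p ^ m : ℕ)) (d₀ : ℤ)
    (htw : ∀ (A : WeierstrassCurve ℚ) [A.IsElliptic], A.HasCM → cmFieldDiscrOfJ A.j = d₀ → ¬ ModPCongruent V A p)
    (h : ∀ d ∈ ({-3, -4, -7, -8, -11, -19, -43, -67, -163} : Finset ℤ), d ≠ d₀ → ∃ (ℓ : ℕ) (_ : Fact ℓ.Prime),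
      ℓ ≠ p ∧ ℓ ≠ 2 ∧ V.HasGoodReductionAtPrime ℓ ∧ ¬ (p : ℤ) ∣ V.frobeniusTrace ℓ ∧ jacobiSym d ℓ = -1) :
    ¬ ∃ (V'' : WeierstrassCurve ℚ) (_ : V''.IsElliptic) (_ : V''.IsGloballyMinimal),
        V''.HasCM ∧ V''.HasGoodReductionAtPrime p ∧ V''.frobeniusTrace p = 0 ∧ ModPCongruent V'' V p := by
  have hp2 : p ≠ 2 := by omega
  obtain ⟨hgood, htr⟩ := good_and_frobeniusTrace_eq_of_countPoints hI p hp2 hΔp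
  rw [hcp] at htr
  have hap : V.frobeniusTrace p = 0 := by rw [htr]; ring
  rintro ⟨A, _, _, hCM, -, -, hAV⟩
  have hVA : ModPCongruent V A p := by
    obtain ⟨e, he⟩ := hAV
    refine ⟨e.symm, fun σ P => e.injective ?_⟩
    rw [e.apply_symm_apply, he, e.apply_symm_apply]
  by_cases hd : cmFieldDiscrOfJ A.j = d₀
  · exact htw A hCM hd hVA
  · obtain ⟨ℓ, _, hℓp, hℓ2, hgoodℓ, ha, hjac⟩ := h _ (cmFieldDiscrOfJ_mem_nine_of_hasCM A hCM) hd
    exact not_modPCongruent_of_hasCM_of_frob_jacobiSym V p hp5 hgood hap hns hCM ℓ hℓp hℓ2 hgoodℓ ha hjac hVA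

/-! ## §1 Reference CM curves for the fields `ℚ(√−11)` and `ℚ(√−1)`: `Δ ≠ 0`, minimality, `j` (kernel) -/

-- `121b1 = [0,−1,1,−7,10]` (CM by `ℤ[(1+√−11)/2]`): `Δ ≠ 0` and global minimality are the tree's
-- `Rank1Residual.X10.CMPartnerCurves.isElliptic_cm121b1` / `isGloballyMinimal_cm121b1` (reused, not restated).

/-- `j(121b1) = −32768 = −2¹⁵`. [cite: Cremona1997, Table 1 (121b1)] [cite: SilvermanAdvancedTopics1994, App. A §3] -/
theorem j_A11 : @WeierstrassCurve.j ℚ _ ⟨0, -1, 1, -7, 10⟩ isElliptic_cm121b1 = -32768 := by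
  rw [@j_eq_c₄_pow_div _ isElliptic_cm121b1]; norm_num [WeierstrassCurve.c₄, WeierstrassCurve.b₂, WeierstrassCurve.b₄,
    WeierstrassCurve.Δ, WeierstrassCurve.b₆, WeierstrassCurve.b₈]

/-- `[0,0,0,−11,14]` (conductor `32`, CM by `ℤ[2i]`): `Δ = 2⁹ ≠ 0`. [cite: Cremona1997, Table 1 (32a)] -/
theorem isElliptic_A16 : (⟨0, 0, 0, -11, 14⟩ : WeierstrassCurve ℚ).IsElliptic :=
  isElliptic_of_discOf_ne_zero 0 0 0 (-11) 14 (by decide +kernel)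

/-- `[0,0,0,−11,14]` is a global minimal equation (kernel: `Δ = 2⁹`, Silverman VII.1 Rem. 1.1). [cite: Cremona1997, Table 1 (32a)]
[cite: SilvermanAEC2009, VII.1 Remark 1.1] -/
theorem isGloballyMinimal_A16 : (⟨0, 0, 0, -11, 14⟩ : WeierstrassCurve ℚ).IsGloballyMinimal :=
  isGloballyMinimal_of_krausCriterion_support 0 0 0 (-11) 14 [(2, 5, 9)] (by decide +kernel) (by decide +kernel) (by decide +kernel)

/-- `j([0,0,0,−11,14]) = 287496 = 66³`. [cite: Cremona1997, Table 1 (32a)] [cite: SilvermanAdvancedTopics1994, App. A §3] -/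
theorem j_A16 : @WeierstrassCurve.j ℚ _ ⟨0, 0, 0, -11, 14⟩ isElliptic_A16 = 287496 := by
  rw [@j_eq_c₄_pow_div _ isElliptic_A16]; norm_num [WeierstrassCurve.c₄, WeierstrassCurve.b₂, WeierstrassCurve.b₄,
    WeierstrassCurve.Δ, WeierstrassCurve.b₆, WeierstrassCurve.b₈]

/-! ## §2 The CM `j`-invariants with field `ℚ(√−11)` and `ℚ(√−1)` -/

/-- The only CM `j`-invariant over `ℚ` with CM field `ℚ(√−11)` is `−32768` (Silverman *AT* App. A §3; the tree's table
`cmFieldDiscrOfJ`). [cite: SilvermanAdvancedTopics1994, App. A §3] -/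
theorem j_eq_of_hasCM_of_cmFieldDiscrOfJ_eq_neg_eleven (A : WeierstrassCurve ℚ) [A.IsElliptic] (hCM : A.HasCM)
    (h : cmFieldDiscrOfJ A.j = -11) : A.j = -32768 := by
  have hj := (hasCM_iff_j_mem_holds A).mp hCM
  simp only [cmJInvariants, Finset.mem_insert, Finset.mem_singleton] at hj
  rcases hj with h' | h' | h' | h' | h' | h' | h' | h' | h' | h' | h' | h' | h'
  all_goals rw [h'] at h ⊢
  all_goals norm_num [cmFieldDiscrOfJ] at h

/-- The CM `j`-invariants over `ℚ` with CM field `ℚ(√−1)` are `1728` (`ℤ[i]`) and `287496` (`ℤ[2i]`) (Silverman *AT* App. A §3; the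
tree's table `cmFieldDiscrOfJ`). [cite: SilvermanAdvancedTopics1994, App. A §3] -/
theorem j_eq_of_hasCM_of_cmFieldDiscrOfJ_eq_neg_four (A : WeierstrassCurve ℚ) [A.IsElliptic] (hCM : A.HasCM)
    (h : cmFieldDiscrOfJ A.j = -4) : A.j = 1728 ∨ A.j = 287496 := by
  have hj := (hasCM_iff_j_mem_holds A).mp hCM
  simp only [cmJInvariants, Finset.mem_insert, Finset.mem_singleton] at hj
  rcases hj with h' | h' | h' | h' | h' | h' | h' | h' | h' | h' | h' | h' | h'
  all_goals rw [h'] at h ⊢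
  all_goals first | exact Or.inl rfl | exact Or.inr rfl | norm_num [cmFieldDiscrOfJ] at h

end Summit.BirchSwinnertonDyer.BirchSwinnertonDyer.Theorems.EtaUncongruentRecordsSeven

end
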